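import Literature.NumberTheory.EllipticCurves.PastenHeightBoundsGRH
import Literature.NumberTheory.EllipticCurves.PastenHeightBoundsProofs
import HarnessLib

/-!
# Pasten 2024, Cor 7.8 (= Thm 1.9), GRH branch, from Thm 7.7 (GRH), and the `abc` form
# `log c ≪ φ(rad) · log log rad` under GRH (proofs)

Topic `Literature/NumberTheory/EllipticCurves` (family `abc`, LADDER-ABC A1, the *modular method*;
cell abc-stewartyu, seat lit-abc-pasten g5). Theorems only — NO new statement, NO new named fact
(D-0026). Companion of `PastenHeightBoundsGRH.lean` (the named fact `PastenShimura2024_thm_7_7_grh`: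
H. Pasten, *Shimura curves and the abc conjecture*, J. Number Theory **254** (2024) =
arXiv:1705.09251v4 [`PastenShimura2024`], Thm 7.7, GRH clauses, arXiv p. 27).

* `PastenShimura2024_cor_7_8_grh` — **Cor 7.8 (= Thm 1.9), GRH branch**, PROVED from the fact: for a
  finite set `S` of places, `P = ∏_{p ∈ S} p`, and `ε > 0`, for `N ≫_{ε,S} 1`, every `E/ℚ` semistable
  away from `S` has, under GRH, `h(E) < (P/φ(P))(ε + 1/24) φ(N) log log N` and
  `log|Δ_E| < (P/φ(P))(ε + 1/2) φ(N) log log N` (p. 27: "under GRH"). The printed proof of Cor 7.8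
  (choice of the admissible `D`, `φ(D)M ≤ φ(N)·(p_N/(p_N − 1))·P/φ(P)`, "`p_N → ∞`") is that of the
  tree's `pasten2024_height_lt_of_admissible_bound` (unconditional branch, `PastenHeightBoundsProofs`);
  its private arithmetic is repeated here (dictionary places/primes, Euler's product, the admissible
  factorisation), with `log log N` in place of `log N` and the bookkeeping constant made a parameter
  (`κ = 1/24` for the height, `κ = 1/2` for the discriminant; threshold `B ≥ 1 + 1/ε`).
* `isSemistableAt_of_dvd_two_pow_mul` — a small public dictionary lemma (`N_E ∣ 2¹⁰ r`, `r`
  squarefree ⇒ `E` semistable away from `2`) used by the companion `PastenHeightBoundsGRHAbcProofs.lean` (the `abc` form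
  `log c ≪ φ(rad) · log log rad` under GRH, through the Frey–Hellegouarch curve).

Nothing about GRH is asserted (hypothesis `hGRH` throughout); no claim on `abc`.

## References

* [PastenShimura2024] H. Pasten, J. Number Theory 254 (2024) = arXiv:1705.09251v4: §2 p. 12, §3 p. 13,
  Thm 7.7 and Cor 7.8 with its proof (p. 27).
* [Silverman1994] J. H. Silverman, GTM 151, IV.10.2, IV.10.4 (`f_p ≤ 1` semistable, `f_p ≤ 8`).
* [MurtyPasten2013] M. R. Murty, H. Pasten, J. Number Theory 133 (2013), §8 (Frey-curve translation).
-/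

noncomputable section

open scoped MatrixGroups ModularForm

open WeierstrassCurve IsDedekindDomain Finset Rat.HeightOneSpectrum CongruenceSubgroup

namespace Literature.NumberTheory.EllipticCurves.ModularForms

/-! ### Real arithmetic of the Euler factor `∏ p/(p-1)` (as in `PastenHeightBoundsProofs`) -/

/-- For a prime `p`: `1 ≤ p/(p−1)` in `ℝ`. [folklore] -/
private theorem one_le_div_pred {p : ℕ} (hp : p.Prime) : (1 : ℝ) ≤ (p : ℝ) / ((p : ℝ) - 1) := by
  have h2 : (2 : ℝ) ≤ p := by exact_mod_cast hp.two_le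
  rw [le_div_iff₀ (by linarith)]
  linarith

/-- `∏_{p ∈ s} p/(p−1) ≤ ∏_{p ∈ t} p/(p−1)` for `s ⊆ t` sets of primes (factors `≥ 1`). [folklore] -/
private theorem prod_div_pred_mono {s t : Finset ℕ} (hst : s ⊆ t) (ht : ∀ p ∈ t, p.Prime) :
    ∏ p ∈ s, ((p : ℝ) / ((p : ℝ) - 1)) ≤ ∏ p ∈ t, ((p : ℝ) / ((p : ℝ) - 1)) :=
  prod_le_prod_of_subset_of_one_le hst
    (fun p hp ↦ zero_le_one.trans (one_le_div_pred (ht p (hst hp))))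
    (fun p hp _ ↦ one_le_div_pred (ht p hp))

/-- **Euler's product formula** `n = φ(n) · ∏_{p ∣ n} p/(p−1)` (Mathlib's
`Nat.totient_mul_prod_primeFactors`). [folklore] -/
private theorem cast_eq_totient_mul_prod (n : ℕ) :
    (n : ℝ) = (n.totient : ℝ) * ∏ p ∈ n.primeFactors, ((p : ℝ) / ((p : ℝ) - 1)) := by
  have h := Nat.totient_mul_prod_primeFactors n
  have hcast : (n.totient : ℝ) * ∏ p ∈ n.primeFactors, (p : ℝ) =
      (n : ℝ) * ∏ p ∈ n.primeFactors, ((p : ℝ) - 1) := by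
    have h' := congrArg (Nat.cast : ℕ → ℝ) h
    simp only [Nat.cast_mul, Nat.cast_prod] at h'
    rw [h']
    congr 1
    refine prod_congr rfl fun p hp ↦ ?_
    rw [Nat.cast_sub (Nat.prime_of_mem_primeFactors hp).one_le, Nat.cast_one]
  have hpos : 0 < ∏ p ∈ n.primeFactors, ((p : ℝ) - 1) := prod_pos fun p hp ↦ by
    have h2 : (2 : ℝ) ≤ p := by exact_mod_cast (Nat.prime_of_mem_primeFactors hp).two_le
    linarith
  rw [prod_div_distrib, mul_div_assoc', hcast, mul_div_assoc, div_self hpos.ne', mul_one]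

/-- `q/(q−1) ≤ (B+1)/B` for real `1 ≤ B`, `B + 1 ≤ q`. [folklore] -/
private theorem div_pred_le {q B : ℝ} (hB : 1 ≤ B) (hq : B + 1 ≤ q) :
    q / (q - 1) ≤ (B + 1) / B := by
  rw [div_le_div_iff₀ (by linarith) (by linarith)]
  have h : (B + 1) * (q - 1) = q * B + (q - (B + 1)) := by ring
  rw [h]
  linarith

/-- The bookkeeping of the proof of Cor 7.8 with a general constant `κ ≥ 0`: from
`h < (ε/2 + κ) φ(D) M X`, `φ(D) M ≤ φ(N) · ((B+1)/B) · g` and `B ≥ 1 + 2κ/ε` (so that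
`(ε/2 + κ)(B+1)/B ≤ ε + κ`) conclude `h < g (ε + κ) φ(N) X` (`X ≥ 0`). [folklore] -/
private theorem lt_combine {h ε κ B φD M φN g X : ℝ} (hε : 0 < ε) (hκ : 0 ≤ κ)
    (hB : 1 + 2 * κ / ε ≤ B) (hlt : h < (ε / 2 + κ) * φD * M * X)
    (hDM : φD * M ≤ φN * ((B + 1) / B) * g) (hX : 0 ≤ X) (hφN : 0 ≤ φN) (hg : 0 ≤ g) :
    h < g * (ε + κ) * φN * X := by
  have hB1 : 1 ≤ B := le_trans (le_add_of_nonneg_right (by positivity)) hB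
  have hBpos : 0 < B := by linarith
  have hconst : (ε / 2 + κ) * ((B + 1) / B) ≤ ε + κ := by
    rw [mul_div_assoc', div_le_iff₀ hBpos]
    have h1 : ε / 2 * (1 + 2 * κ / ε) = ε / 2 + κ := by field_simp
    have h2 : ε / 2 * (1 + 2 * κ / ε) ≤ ε / 2 * B := mul_le_mul_of_nonneg_left hB (by linarith)
    nlinarith [h1 ▸ h2]
  have hc0 : (0 : ℝ) ≤ ε / 2 + κ := by positivity
  calc h < (ε / 2 + κ) * φD * M * X := hlt
    _ = (ε / 2 + κ) * (φD * M) * X := by ring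
    _ ≤ (ε / 2 + κ) * (φN * ((B + 1) / B) * g) * X :=
        mul_le_mul_of_nonneg_right (mul_le_mul_of_nonneg_left hDM hc0) hX
    _ = g * ((ε / 2 + κ) * ((B + 1) / B)) * φN * X := by ring
    _ ≤ g * (ε + κ) * φN * X :=
        mul_le_mul_of_nonneg_right (mul_le_mul_of_nonneg_right
          (mul_le_mul_of_nonneg_left hconst hg) hφN) hX

/-! ### The two arithmetic steps of the proof of Cor 7.8 (as in `PastenHeightBoundsProofs`) -/

/-- `n = ∏_{p ∣ n} p ^ {v_p(n)}` over `n.primeFactors`. [folklore] -/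
private theorem prod_primeFactors_pow_factorization {n : ℕ} (hn : n ≠ 0) :
    ∏ p ∈ n.primeFactors, p ^ n.factorization p = n := by
  conv_rhs => rw [← Nat.prod_factorization_pow_eq_self hn]
  rw [Finsupp.prod, Nat.support_factorization]

/-- "`p_N → ∞` as `N → ∞`" (proof of Cor 7.8), elementary form: if `v_p(N) ≤ 8` for all `p` and
`N > (∏_{p ∈ Sp ∪ {primes ≤ B}} p)⁸`, then `N` has a prime factor `q ∉ Sp` with `q > B`.
[cite: PastenShimura2024, Cor 7.8 (proof, p. 27)] -/
private theorem exists_big_primeFactor {N : ℕ} (hN : N ≠ 0) (Sp : Finset ℕ)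
    (hSp : ∀ p ∈ Sp, p.Prime) (B : ℕ) (h8 : ∀ p, N.factorization p ≤ 8)
    (hbig : (∏ p ∈ Sp ∪ (range (B + 1)).filter Nat.Prime, p) ^ 8 < N) :
    ∃ q ∈ N.primeFactors, q ∉ Sp ∧ B < q := by
  classical
  by_contra hcon
  push Not at hcon
  have hsub : N.primeFactors ⊆ Sp ∪ (range (B + 1)).filter Nat.Prime := fun q hq ↦
    (em (q ∈ Sp)).elim (mem_union_left _) fun hqS ↦ mem_union_right _ (mem_filter.2
      ⟨mem_range.2 (Nat.lt_succ_of_le (hcon q hq hqS)), Nat.prime_of_mem_primeFactors hq⟩)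
  have hdvd : N ∣ (∏ p ∈ Sp ∪ (range (B + 1)).filter Nat.Prime, p) ^ 8 :=
    calc N = ∏ p ∈ N.primeFactors, p ^ N.factorization p :=
          (prod_primeFactors_pow_factorization hN).symm
      _ ∣ ∏ p ∈ N.primeFactors, p ^ 8 :=
          prod_dvd_prod_of_dvd _ _ fun p _ ↦ pow_dvd_pow p (h8 p)
      _ ∣ ∏ p ∈ Sp ∪ (range (B + 1)).filter Nat.Prime, p ^ 8 :=
          prod_dvd_prod_of_subset _ _ _ hsub
      _ = (∏ p ∈ Sp ∪ (range (B + 1)).filter Nat.Prime, p) ^ 8 := prod_pow _ _ _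
  have h0 : (∏ p ∈ Sp ∪ (range (B + 1)).filter Nat.Prime, p) ^ 8 ≠ 0 := by
    refine pow_ne_zero _ (prod_ne_zero_iff.2 fun p hp ↦ ?_)
    rcases mem_union.1 hp with hp | hp
    · exact (hSp p hp).ne_zero
    · exact (mem_filter.1 hp).2.ne_zero
  exact absurd (Nat.le_of_dvd (Nat.pos_of_ne_zero h0) hdvd) (not_le.2 hbig)

/-- The admissible factorisation of the proof of Cor 7.8 (p. 27): `N = D M`, `D` = the primes of
`N` outside `Sp` (dropping `q` if their number is odd), `M = N/D`.
[cite: PastenShimura2024, Cor 7.8 (proof, p. 27)] -/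
private theorem exists_admissible_factorisation {N : ℕ} (hN : N ≠ 0) (Sp : Finset ℕ)
    (hsemi : ∀ p ∈ N.primeFactors, p ∉ Sp → N.factorization p = 1)
    {q : ℕ} (hq : q ∈ N.primeFactors) (hqS : q ∉ Sp) :
    ∃ D M : ℕ, N = D * M ∧ Squarefree D ∧ Even D.primeFactors.card ∧ D.Coprime M ∧
      M ≠ 0 ∧ M.primeFactors ⊆ insert q Sp := by
  classical
  set T : Finset ℕ := N.primeFactors.filter (· ∉ Sp)
  have hqT : q ∈ T := mem_filter.2 ⟨hq, hqS⟩
  obtain ⟨U, hUT, hUeven, hTU⟩ :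
      ∃ U : Finset ℕ, U ⊆ T ∧ Even U.card ∧ T ⊆ insert q U := by
    rcases Nat.even_or_odd T.card with he | ho
    · exact ⟨T, Subset.rfl, he, subset_insert _ _⟩
    · refine ⟨T.erase q, erase_subset _ _, ?_, fun p hp ↦ by rwa [insert_erase hqT]⟩
      rw [card_erase_of_mem hqT]
      exact ho.imp fun k hk ↦ by omega
  have hUpf : U ⊆ N.primeFactors := hUT.trans (filter_subset _ _)
  have hUprime : ∀ p ∈ U, p.Prime := fun p hp ↦ Nat.prime_of_mem_primeFactors (hUpf hp)
  have hUfac : ∀ p ∈ U, N.factorization p = 1 := fun p hp ↦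
    hsemi p (hUpf hp) (mem_filter.1 (hUT hp)).2
  refine ⟨∏ p ∈ U, p, ∏ p ∈ N.primeFactors \ U, p ^ N.factorization p, ?_, ?_, ?_, ?_, ?_, ?_⟩
  · calc N = ∏ p ∈ N.primeFactors, p ^ N.factorization p :=
          (prod_primeFactors_pow_factorization hN).symm
      _ = (∏ p ∈ U, p ^ N.factorization p) * ∏ p ∈ N.primeFactors \ U, p ^ N.factorization p := by
          rw [← prod_sdiff hUpf, mul_comm]
      _ = (∏ p ∈ U, p) * ∏ p ∈ N.primeFactors \ U, p ^ N.factorization p := by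
          congr 1
          exact prod_congr rfl fun p hp ↦ by rw [hUfac p hp, pow_one]
  · exact Finset.squarefree_prod_of_pairwise_isCoprime
      (fun p hp r hr hpr ↦ Nat.coprime_iff_isRelPrime.1
        ((Nat.coprime_primes (hUprime p hp) (hUprime r hr)).2 hpr))
      (fun p hp ↦ (hUprime p hp).prime.squarefree)
  · rwa [Nat.primeFactors_prod hUprime]
  · refine Nat.Coprime.prod_left fun p hp ↦ Nat.Coprime.prod_right fun r hr ↦ ?_
    have hpr : p ≠ r := fun h ↦ (mem_sdiff.1 hr).2 (h ▸ hp)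
    exact ((Nat.coprime_primes (hUprime p hp)
      (Nat.prime_of_mem_primeFactors (mem_sdiff.1 hr).1)).2 hpr).pow_right _
  · exact prod_ne_zero_iff.2 fun p hp ↦
      pow_ne_zero _ (Nat.prime_of_mem_primeFactors (mem_sdiff.1 hp).1).ne_zero
  · intro r hr
    have hrprime := Nat.prime_of_mem_primeFactors hr
    obtain ⟨p, hp, hrp⟩ := (hrprime.prime.dvd_finsetProd_iff _).1 (Nat.dvd_of_mem_primeFactors hr)
    have hp' := mem_sdiff.1 hp
    have hr_eq : r = p :=
      (Nat.prime_dvd_prime_iff_eq hrprime (Nat.prime_of_mem_primeFactors hp'.1)).1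
        (hrprime.dvd_of_dvd_pow hrp)
    subst hr_eq
    by_cases hrS : r ∈ Sp
    · exact mem_insert_of_mem hrS
    · rcases mem_insert.1 (hTU (mem_filter.2 ⟨hp'.1, hrS⟩)) with rfl | h
      · exact mem_insert_self _ _
      · exact absurd h hp'.2

/-! ### Dictionary: places of `ℤ`, rational primes, the conductor -/

section Dictionary

/-- `natGenerator : HeightOneSpectrum ℤ → ℕ` is injective (via `primesEquiv`). [folklore] -/
private theorem natGenerator_injective' : Function.Injective (natGenerator (R := ℤ)) :=
  fun _ _ h ↦ primesEquiv.injective (Subtype.ext h)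

/-- The rational prime below the place `primesEquiv.symm p` is `p`. [folklore] -/
private theorem natGenerator_primesEquiv_symm' (p : Nat.Primes) :
    natGenerator ((primesEquiv (R := ℤ)).symm p) = p :=
  congrArg Subtype.val ((primesEquiv (R := ℤ)).apply_symm_apply p)

/-- Over `ℤ`: `N(𝔭_v) = p_v`. [folklore] -/
private theorem absNorm_asIdeal_eq_natGenerator' (v : HeightOneSpectrum ℤ) :
    Ideal.absNorm v.asIdeal = natGenerator v := by
  have h : v.asIdeal = Ideal.span {(natGenerator v : ℤ)} := by
    rw [span_natGenerator, ← Ideal.comap_symm]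
    ext x
    rw [Ideal.mem_comap, eq_intCast, Int.cast_id]
  rw [h, Ideal.absNorm_span_natCast, Module.finrank_self, pow_one]

/-- `∏_{v ∈ S} N(𝔭_v) = ∏_{p ∈ p(S)} p`. [folklore] -/
private theorem prod_absNorm_eq (S : Finset (HeightOneSpectrum ℤ)) :
    ∏ v ∈ S, Ideal.absNorm v.asIdeal = ∏ p ∈ S.image natGenerator, p := by
  rw [prod_image fun v _ w _ h ↦ natGenerator_injective' h]
  exact prod_congr rfl fun v _ ↦ absNorm_asIdeal_eq_natGenerator' v

variable (W : WeierstrassCurve ℚ) [W.IsElliptic]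

/-- `v_p(N_E) = f_{v_p}` at `v_p = primesEquiv.symm p`. [folklore] -/
private theorem factorization_primesEquiv_symm (p : Nat.Primes) :
    (W.conductorNorm ℤ).factorization p = W.conductorExponent ((primesEquiv (R := ℤ)).symm p) := by
  have h : (W.conductorNorm ℤ).factorization (natGenerator ((primesEquiv (R := ℤ)).symm p)) =
      W.conductorExponent ((primesEquiv (R := ℤ)).symm p) :=
    WeierstrassCurve.factorization_conductorNorm_holds W _
  rwa [natGenerator_primesEquiv_symm'] at h

/-- Semistable at `v` iff `f_v ≤ 1`. [cite: Silverman1994, IV.10.2] -/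
private theorem isSemistableAt_iff_conductorExponent_le_one' (v : HeightOneSpectrum ℤ) :
    W.IsSemistableAt v ↔ W.conductorExponent v ≤ 1 := by
  have h0 : W.conductorExponent v = 0 ↔ W.HasGoodReductionAt v :=
    WeierstrassCurve.conductorExponent_eq_zero_iff_holds v W
  have h1 : W.conductorExponent v = 1 ↔ W.HasMultiplicativeReductionAt v :=
    WeierstrassCurve.conductorExponent_eq_one_iff_holds v W
  rw [WeierstrassCurve.IsSemistableAt, ← h0, ← h1]
  omega

/-- `v_p(N_E) ≤ 8` for every `p`. [cite: Silverman1994, IV.10.4] -/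
private theorem factorization_conductorNorm_le_eight (p : ℕ) :
    (W.conductorNorm ℤ).factorization p ≤ 8 := by
  by_cases hp : p.Prime
  · rw [factorization_primesEquiv_symm W ⟨p, hp⟩]
    exact WeierstrassCurve.conductorExponent_le_eight_holds W _
  · exact (Nat.factorization_eq_zero_of_not_prime _ hp).trans_le (Nat.zero_le _)

/-- Semi-stable away from `S` ⇒ every prime of `N_E` outside the primes of `S` divides `N_E`
exactly once. [cite: Silverman1994, IV.10.2] -/
private theorem factorization_conductorNorm_eq_one (S : Finset (HeightOneSpectrum ℤ))
    (hss : ∀ v : HeightOneSpectrum ℤ, v ∉ S → W.IsSemistableAt v) {p : ℕ}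
    (hp : p ∈ (W.conductorNorm ℤ).primeFactors) (hpS : p ∉ S.image natGenerator) :
    (W.conductorNorm ℤ).factorization p = 1 := by
  have hpprime := Nat.prime_of_mem_primeFactors hp
  have hvS : (primesEquiv (R := ℤ)).symm ⟨p, hpprime⟩ ∉ S := fun h ↦
    hpS (mem_image.2 ⟨_, h, natGenerator_primesEquiv_symm' ⟨p, hpprime⟩⟩)
  have hle : (W.conductorNorm ℤ).factorization p ≤ 1 := by
    rw [factorization_primesEquiv_symm W ⟨p, hpprime⟩]
    exact (isSemistableAt_iff_conductorExponent_le_one' W _).1 (hss _ hvS)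
  have hN : 0 < W.conductorNorm ℤ := WeierstrassCurve.conductorNorm_pos_holds W
  have hpos : 0 < (W.conductorNorm ℤ).factorization p :=
    hpprime.factorization_pos_of_dvd hN.ne' (Nat.dvd_of_mem_primeFactors hp)
  omega

/-- If `N_E ∣ 2¹⁰ r` with `r` squarefree then `E` is semistable away from `2` (`f_p ≤ v_p(r) ≤ 1`
for odd `p`). [cite: Silverman1994, IV.10.2] -/
theorem isSemistableAt_of_dvd_two_pow_mul {r : ℕ} (hr : Squarefree r)
    (hN : W.conductorNorm ℤ ∣ 2 ^ 10 * r) (v : HeightOneSpectrum ℤ)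
    (hv : v ≠ (primesEquiv (R := ℤ)).symm ⟨2, Nat.prime_two⟩) : W.IsSemistableAt v := by
  rw [isSemistableAt_iff_conductorExponent_le_one']
  have hveq : (primesEquiv (R := ℤ)).symm (primesEquiv v) = v := (primesEquiv (R := ℤ)).symm_apply_apply v
  have hp : (natGenerator v).Prime := prime_natGenerator v
  have hp2 : natGenerator v ≠ 2 := by
    intro h2
    apply hv
    rw [← hveq]
    congr 1
    exact Subtype.ext h2
  have h1 : (W.conductorNorm ℤ).factorization (natGenerator v) = W.conductorExponent v := by
    have := factorization_primesEquiv_symm W (primesEquiv v)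
    rwa [hveq] at this
  rw [← h1]
  have hr0 : r ≠ 0 := hr.ne_zero
  have h2 : (W.conductorNorm ℤ).factorization (natGenerator v) ≤
      (2 ^ 10 * r).factorization (natGenerator v) :=
    (Nat.factorization_le_iff_dvd (WeierstrassCurve.conductorNorm_pos_holds W).ne' (by positivity)).2
      hN _
  have hndvd : ¬ natGenerator v ∣ 2 ^ 10 := fun h ↦
    hp2 ((Nat.prime_dvd_prime_iff_eq hp Nat.prime_two).1 (hp.dvd_of_dvd_pow h))
  have h3 : (2 ^ 10 * r).factorization (natGenerator v) = r.factorization (natGenerator v) := by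
    rw [Nat.factorization_mul (by positivity) hr0, Finsupp.add_apply,
      Nat.factorization_eq_zero_of_not_dvd hndvd, zero_add]
  have h4 : r.factorization (natGenerator v) ≤ 1 :=
    (Nat.squarefree_iff_factorization_le_one hr0).1 hr _
  omega

end Dictionary

/-! ### Cor 7.8 (GRH branch) from Thm 7.7 (GRH clauses) -/

/-- `0 ≤ log log N` for `N ≥ 16`. [folklore] -/
private theorem loglog_nonneg {N : ℕ} (hN : 16 ≤ N) : 0 ≤ Real.log (Real.log (N : ℝ)) := by
  have hN' : (16 : ℝ) ≤ N := by exact_mod_cast hN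
  have hl2 := Real.log_two_gt_d9
  have h16 : Real.log 16 = 4 * Real.log 2 := by
    rw [show (16 : ℝ) = 2 ^ 4 by norm_num, Real.log_pow]; norm_num
  have hlog16 : Real.log 16 ≤ Real.log N := Real.log_le_log (by norm_num) hN'
  exact Real.log_nonneg (by linarith)

/-- **Pasten 2024, Cor 7.8 = Thm 1.9, GRH branch, from Thm 7.7 (GRH)** — the printed proof of Cor 7.8
(p. 27) run on the GRH clauses: for a finite set `S` of places with `P = ∏_{p ∈ S} p` and `ε > 0`,
for `N ≫_{ε,S} 1`, every `E/ℚ` semistable away from `S` satisfies, under GRH,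
`h(E) < (P/φ(P))(ε + 1/24) φ(N) log log N` and `log|Δ_E| < (P/φ(P))(ε + 1/2) φ(N) log log N`.
Proof as printed: Thm 7.7 (GRH) with `ε/2` for `D = ∏{p ∣ N, p ∉ S}` (dropping a prime `q > B` of
`N` outside `S` if the number of such primes is odd), `φ(D)M ≤ φ(N)(q/(q−1)) P/φ(P) ≤
φ(N)((B+1)/B) P/φ(P)`, `B ≥ 1 + 1/ε`, `N > (∏_{p ∈ S ∪ {p ≤ B}} p)⁸` ("`p_N → ∞`", here by
`f_p ≤ 8`). [cite: PastenShimura2024, Cor 7.8 (GRH clauses) and its proof, arXiv p. 27] -/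
theorem PastenShimura2024_cor_7_8_grh (h77 : PastenShimura2024_thm_7_7_grh)
    (hGRH : ∀ (N₁ N₂ : ℕ) [NeZero N₁] [NeZero N₂] (f : CuspForm (Gamma0 N₁) 2)
      (g : CuspForm (Gamma0 N₂) 2), IsNewform0 f → IsNewform0 g → RankinSelbergGRH f g)
    (S : Finset (HeightOneSpectrum ℤ)) {ε : ℝ} (hε : 0 < ε) :
    ∃ N₀ : ℕ, ∀ (W : WeierstrassCurve ℚ) [W.IsElliptic] [W.IsGloballyMinimal] (L : PeriodPair),
      IsNeronLatticeOf (W.baseChange ℂ) L →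
      (∀ v : HeightOneSpectrum ℤ, v ∉ S → W.IsSemistableAt v) →
      N₀ ≤ W.conductorNorm ℤ →
        neronLatticeHeight L <
            ((∏ v ∈ S, (Ideal.absNorm v.asIdeal : ℝ)) /
                (Nat.totient (∏ v ∈ S, Ideal.absNorm v.asIdeal) : ℝ)) *
              (ε + 1 / 24) * (Nat.totient (W.conductorNorm ℤ) : ℝ) *
              Real.log (Real.log (W.conductorNorm ℤ : ℝ)) ∧
          Real.log (W.minimalDiscriminantNorm ℤ : ℝ) <
            ((∏ v ∈ S, (Ideal.absNorm v.asIdeal : ℝ)) /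
                (Nat.totient (∏ v ∈ S, Ideal.absNorm v.asIdeal) : ℝ)) *
              (ε + 1 / 2) * (Nat.totient (W.conductorNorm ℤ) : ℝ) *
              Real.log (Real.log (W.conductorNorm ℤ : ℝ)) := by
  classical
  -- the primes of `S` and their product `P`
  set Sp : Finset ℕ := S.image natGenerator
  have hSp : ∀ p ∈ Sp, p.Prime := fun p hp ↦ by
    obtain ⟨v, -, rfl⟩ := mem_image.1 hp
    exact prime_natGenerator v
  set P : ℕ := ∏ p ∈ Sp, p
  have hP0 : P ≠ 0 := prod_ne_zero_iff.2 fun p hp ↦ (hSp p hp).ne_zero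
  have hPpf : P.primeFactors = Sp := Nat.primeFactors_prod hSp
  have hPeq : ∏ v ∈ S, Ideal.absNorm v.asIdeal = P := prod_absNorm_eq S
  have hPreal : (∏ v ∈ S, (Ideal.absNorm v.asIdeal : ℝ)) = (P : ℝ) := by
    rw [← hPeq, Nat.cast_prod]
  -- Thm 7.7 (GRH) with `ε/2`; the threshold `B` for `q/(q-1) ≤ (B+1)/B`; the size `N₂` forcing `q > B`
  obtain ⟨N₁, hN₁⟩ := h77 hGRH (ε / 2) (half_pos hε)
  set B : ℕ := ⌈1 + 1 / ε⌉₊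
  have hB1 : (1 : ℝ) + 1 / ε ≤ B := Nat.le_ceil _
  have hB1' : (1 : ℝ) ≤ B := (le_add_of_nonneg_right (by positivity)).trans hB1
  have hBa : (1 : ℝ) + 2 * (1 / 24) / ε ≤ B := by
    have h1 : 2 * (1 / 24 : ℝ) / ε ≤ 1 / ε := by
      rw [div_le_div_iff₀ hε hε]; nlinarith
    linarith
  have hBb : (1 : ℝ) + 2 * (1 / 2) / ε ≤ B := by
    have h1 : 2 * (1 / 2 : ℝ) / ε = 1 / ε := by ring
    linarith
  set N₂ : ℕ := (∏ p ∈ Sp ∪ (range (B + 1)).filter Nat.Prime, p) ^ 8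
  refine ⟨max N₁ (max (N₂ + 1) 16), fun W _ _ L hL hss hN ↦ ?_⟩
  rw [hPreal, hPeq]
  have hN1 : N₁ ≤ W.conductorNorm ℤ := le_of_max_le_left hN
  have hN2 : N₂ < W.conductorNorm ℤ :=
    Nat.lt_of_succ_le (le_of_max_le_left (le_of_max_le_right hN))
  have hN16 : 16 ≤ W.conductorNorm ℤ := le_of_max_le_right (le_of_max_le_right hN)
  have hN0 : W.conductorNorm ℤ ≠ 0 :=
    (WeierstrassCurve.conductorNorm_pos_holds W : 0 < W.conductorNorm ℤ).ne'
  -- a prime `q ∣ N` outside `S` with `q > B`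
  obtain ⟨q, hq, hqS, hBq⟩ := exists_big_primeFactor hN0 Sp hSp B
    (factorization_conductorNorm_le_eight W) hN2
  have hqprime : q.Prime := Nat.prime_of_mem_primeFactors hq
  -- the admissible factorisation `N = D M`
  obtain ⟨D, M, hNDM, hDsq, hDeven, hDM, hM0, hMpf⟩ := exists_admissible_factorisation hN0 Sp
    (fun p hp hpS ↦ factorization_conductorNorm_eq_one W S hss hp hpS) hq hqS
  -- Thm 7.7 (GRH) for this factorisation
  have hlt := hN₁ W L hL D M hNDM hDsq hDeven hDM hN1
  -- `φ(D) M ≤ φ(N) · ((B+1)/B) · P/φ(P)`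
  have hφDM : (D.totient : ℝ) * M ≤
      ((W.conductorNorm ℤ).totient : ℝ) * (((B : ℝ) + 1) / B) * ((P : ℝ) / (P.totient : ℝ)) := by
    have hM := cast_eq_totient_mul_prod M
    have hφN : ((W.conductorNorm ℤ).totient : ℝ) = D.totient * M.totient := by
      rw [hNDM, Nat.totient_mul hDM, Nat.cast_mul]
    have hg : ∏ p ∈ M.primeFactors, ((p : ℝ) / ((p : ℝ) - 1)) ≤
        (q : ℝ) / ((q : ℝ) - 1) * ∏ p ∈ Sp, ((p : ℝ) / ((p : ℝ) - 1)) :=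
      (prod_div_pred_mono hMpf fun p hp ↦ by
        rcases mem_insert.1 hp with rfl | hp
        exacts [hqprime, hSp p hp]).trans (prod_insert hqS).le
    have hgP : ∏ p ∈ Sp, ((p : ℝ) / ((p : ℝ) - 1)) = (P : ℝ) / (P.totient : ℝ) := by
      have hPc := cast_eq_totient_mul_prod P
      have hφP : (0 : ℝ) < P.totient := by exact_mod_cast Nat.totient_pos.2 (Nat.pos_of_ne_zero hP0)
      rw [hPpf] at hPc
      rw [eq_div_iff hφP.ne', mul_comm, ← hPc]
    have hq3 : (q : ℝ) / ((q : ℝ) - 1) ≤ ((B : ℝ) + 1) / B :=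
      div_pred_le hB1' (by exact_mod_cast Nat.succ_le_of_lt hBq)
    have hgS0 : 0 ≤ ∏ p ∈ Sp, ((p : ℝ) / ((p : ℝ) - 1)) :=
      prod_nonneg fun p hp ↦ zero_le_one.trans (one_le_div_pred (hSp p hp))
    calc (D.totient : ℝ) * M
        = D.totient * (M.totient * ∏ p ∈ M.primeFactors, ((p : ℝ) / ((p : ℝ) - 1))) := by
          rw [← hM]
      _ ≤ D.totient * (M.totient *
            (((B : ℝ) + 1) / B * ∏ p ∈ Sp, ((p : ℝ) / ((p : ℝ) - 1)))) :=
          mul_le_mul_of_nonneg_left (mul_le_mul_of_nonneg_left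
            (hg.trans (mul_le_mul_of_nonneg_right hq3 hgS0)) (Nat.cast_nonneg _))
            (Nat.cast_nonneg _)
      _ = ((W.conductorNorm ℤ).totient : ℝ) * (((B : ℝ) + 1) / B) * ((P : ℝ) / (P.totient : ℝ)) := by
          rw [hφN, hgP]; ring
  have hX : 0 ≤ Real.log (Real.log (W.conductorNorm ℤ : ℝ)) := loglog_nonneg hN16
  -- conclude (height: `κ = 1/24`; discriminant: `κ = 1/2`)
  constructor
  · exact lt_combine hε (by norm_num) hBa hlt.1 hφDM hX (Nat.cast_nonneg _) (by positivity)
  · exact lt_combine hε (by norm_num) hBb hlt.2 hφDM hX (Nat.cast_nonneg _) (by positivity)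

end Literature.NumberTheory.EllipticCurves.ModularForms

end
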